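import Summits.QuantumFields.YangMills.Theorems.FluctuationComparisonRegPrIntLOrganTangentJunctionDirectTransportCore
import HarnessLib

/-!
# Crux `FluctuationComparisonRegPrIntL` (stmt-QuantumFields-20520, rung R3), PATH-B organ, v18 (H-currency): THE JUNCTION `O1ᵘ-H v2 ⟹ S3ᴴ`,
# PART 2 — ★★`directTransport_supR` and ★★`backwardStabilityFinSupH_of_oneStepTransportUH` (Theorems-side DEF-FREE LIFT of the ideator's crux file
# `Cruxes/FluctuationComparisonRegPrIntL/JunctionDirectTransport.lean` v1.2, sha16 754f1386b6161105, §E second half + §F)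

Cell `ym3-torus` (YM ladder rung R3 = continuum `SU(2)` Yang–Mills on the three-torus — a RUNG: NOT d = 4, NOT infinite volume, NOT a mass gap, NOT Clay).
AUTHOR of the mathematics and of every statement∕proof: ideator `ym-r3-idea-1` g27; LIFTED by width seat `ym3-torus-px19` (gen 18) at text freeze
(LEAD `ym-ust-20520-w3` g24 ■ FINAL 01:56Z; №9 (B)∕№13∕№17; ★★OWNER №282∕№284∕№300); `--kind proof --supports stmt-QuantumFields-20520 --as helper`,
count-neutral; DEFINITION-FREE: the hypothesis `hO` IS the O1ᵘ-H v2 text of `V18DraftTexts.lean` v0.3 (44402e64e82bae84; unchanged since v0.2) with `sfCut`∕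
`HClauseSq`∕`AnalyticPairWindowAt` INLINED and implicit lattice indices as `_`, the conclusion IS the S3ᴴ text likewise inlined; (P-b′) enters BY NAME
(✓p798086 `OrganTangentSmallStepChordPath.exists_smallStep_chordPath_gaugeCopy`; the crux file's restatement `smallStepChordPath_holds` is NOT re-landed).
So: **S3ᴴ ⟸ O1ᵘ-H v2 ALONE, by kernel**, and `Lines/runpair_organ.lean` v18 closes `stub S3ᴴ` by
`backwardStabilityFinSupH_of_oneStepTransportUH stub_oneStepTransportUH` (defeq through the Lines file's own `def`s).

ROUTE (ideator g27): O1ᵘ-H v2 (direct transport from the seed height `T` to `j`) gives the OUTPUT presentation `(c′, a′, w′, k′)` at `j` — a marginal of size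
`a′` and an H-clause for `R_j := h_j − marginal(c′)` on the `θ_j∕4`-window with cap `r` and letters `k′ ≤ w′`; (P-b′) at path profile `b₀∕8` joins `1` to a gauge
copy `U^u` of every inner-window `U` by right exponential moves of size `≤ σ·θ_j∕4` with volume-uniform per-bond count; `R_j` is gauge invariant (✓p794698), so
TN-OSC (✓p799177) bounds `|R_j U − R_j 1| ≤ 1.5·w′·(nσ)²`, `nσ ≤ 10·#PBond_j∕√θ_j`; the marginal contributes `≤ 2a′·β_j·#Plaq_j`; at `j = T` the seed
clause itself is the H-clause.  Core lemmas: `…OrganTangentJunctionDirectTransportCore`.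

HONEST FRAMING: bookkeeping over HYPOTHESES (triangle inequalities, an induction, real arithmetic); nothing of Bałaban's analysis is asserted or
proved; O1ᵘ-H v2 (the binder `hO`, XL — the crux of the crux) and S1aᴴ are HYPOTHESES of the v18 line; S3ᴴ is proved FROM O1ᵘ-H v2 + (P-b′), nothing more;
O1∕O1ᵘ-H∕crux 20520 `FluctuationComparisonRegPrIntL`∕`YM3TorusSU2` are NOT proved; registry `Lines/semiclassical_s2beta.lean` v11.4 (★★OWNER RULING №36)
and `Lines/runpair_organ.lean` v17.2 untouched by this file; rung R3 = SU(2) YM₃ on T³ at fixed lattice data — NOT d = 4, NOT infinite volume, NOT a mass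
gap, NOT Clay; the Yang–Mills mass gap is NOT proved.

References: T. Bałaban, CMP **102** (1985) 255–275 [Balaban1985UV3] (p.263 (c)); CMP **109** (1987) 249–301 [Balaban1987RG1] ((0.4) p.253); CMP **116**
(1988) 1–22 [Balaban1988RG2] ((0.3)–(0.12)); CMP **98** (1985) 17–51 [Balaban1985Averaging] ((8), (11)–(13) p.19).
-/

set_option autoImplicit false

noncomputable section

open MeasureTheory Filter Topology Function
open Literature.MathematicalPhysics.QuantumFieldTheory.Balaban1983to89 T3ContinuumYM3Torus T3NestedUnitLaws
  T3UnitLawDensityEML T4Continuum BalabanUVClass T3UnitScaleTilt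
open T4CubeChartGnomonic (SU2)
open T4HaarSU2ExpChart (expPoint)
open T4CubeChartExp (expPt toE)
open B15SU2ChartHolomorphic (expPointC coe_expPoint_eq_expPointC)
open Summit.QuantumFields.YangMills.Theorems.OrganTangentTelescopeWindowPath (firstDiff_step_on clause_update_of_HClauseSq)
open Summit.QuantumFields.YangMills.Theorems.OrganTangentSmallStepOneBond (plaqDev_update_le)
open scoped BigOperators

open Summit.QuantumFields.YangMills.Theorems.OrganTangentAnchorFreeOscillation
open Summit.QuantumFields.YangMills.Theorems.OrganTangentJunctionDirectTransportCore

namespace Summit.QuantumFields.YangMills.Theorems.OrganTangentJunctionDirectTransport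

/-- ★★ THE JUNCTION (v18 H-currency, TN-OSC edition): O1ᵘ-H v2's direct transport from the seed height `T` to every `j ∈ [j₁, T)` (and the
seed clause itself at `j = T`), the gauge invariance of the organ's remainder (✓p794698) and its flat inversion-evenness (✓p793256),
(P-b′)'s volume-uniform chord path inside the `θ_j∕8`-window, and TN-ANCHOR-FREE + TN-OSC give S3ᴴ with `Cs := (150∕θ + 150)·(Ctr + Σεd + C·w₀)`,
`δ′ := (150∕θ + 150)·δ`, `w₀ := w₀`, `j₁ := max j₁ (max jW jθ)`.  [bookkeeping over hypotheses; nothing of Bałaban's asserted] -/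
theorem directTransport_supR (hO : (∃ γ₁ : ℝ, 0 < γ₁ ∧ ∀ (F : T3Family) (γ : ℝ), 0 < γ → γ ≤ γ₁ → ∀ (b₀ p₀ : ℝ) (j₀ : ℕ) (prm : ℕ → ClassParams) (η : ℕ → ℝ) (rA : ℝ) (Bρ : ℕ → ℝ), 0 < b₀ → 0 < p₀ → AdmissibleClassParams F γ b₀ p₀ prm → (∀ j, 0 ≤ η j) → Summable η → Summable (fun i => ∑' k, η (k + i)) → Tendsto (fun j => (∑' k, η (k + j)) * ((1 + 2 * ((F.L : ℝ) ^ j / γ) * (Fintype.card (Plaq (F.P j) 0) : ℝ)) * (Fintype.card (PBond (F.P j) 0) : ℝ) ^ 2)) atTop (𝓝 0) → 0 < rA → ∃ κ₀ : ℝ, 0 < κ₀ ∧ ∀ (κ : ℝ), 0 < κ → κ ≤ κ₀ → ∃ (θ r Ctr C w₀ : ℝ) (εd δ : ℕ → ℝ) (j₁ : ℕ), 0 < θ ∧ 0 < r ∧ 1 ≤ Ctr ∧ 0 ≤ C ∧ 0 < w₀ ∧ (∀ j, 0 ≤ εd j ∧ 0 ≤ δ j) ∧ Summable εd ∧ Summable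 δ ∧ Summable (fun i => ∑' k, δ (k + i)) ∧ Tendsto (fun j => (∑' k, δ (k + j)) * ((1 + 2 * ((F.L : ℝ) ^ j / γ) * (Fintype.card (Plaq (F.P j) 0) : ℝ)) * (Fintype.card (PBond (F.P j) 0) : ℝ) ^ 2)) atTop (𝓝 0) ∧ j₀ ≤ j₁ ∧ ∀ (ν : ℕ → (j : ℕ) → MeasureTheory.Measure (GaugeField (F.P j) 0 ↥(Matrix.specialUnitaryGroup (Fin 2) ℂ))), (∀ K, ν K K = T4GenFunBounds.gibbsMeasure (F.P K) ((F.scheme ℰp γ).β K)) → (∀ K j, j < K → ν K j = Measure.map (descend F ℰp j) (ν K (j + 1))) → ∀ (K K' : ℕ), K ≤ K' → ∀ (Ts T : ℕ), Ts < T → T ≤ K → ∀ (μ μ' : ((j : ℕ) → MeasureTheory.Measure (GaugeField (F.P j) 0 ↥(Matrix.specialUnitaryGroup (Fin 2) ℂ)))) (ρ ρ' : ((j : ℕ) → GaugeField (F.P j) 0 ↥(Matrix.specialUnitaryGroup (Fin 2) ℂ) → ℝ)), (∀ j : ℕ, Ts ≤ j → j ≤ T → μ j = ν K j ∧ μ'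 j = ν K' j) → (∀ j : ℕ, j < Ts → μ j = Measure.map (descend F ℰp j) ((μ (j + 1)).withDensity (fun U => ENNReal.ofReal ((∏ p : Plaq _ _, max 0 (min 1 ((24 / 25 * (θBal F.L γ b₀ p₀ (j + 1)) - dist1 (GaugeField.plaqHol U p)) / ((24 / 25 - 1 / 2) * (θBal F.L γ b₀ p₀ (j + 1))))))))) ∧ μ' j = Measure.map (descend F ℰp j) ((μ' (j + 1)).withDensity (fun U => ENNReal.ofReal ((∏ p : Plaq _ _, max 0 (min 1 ((24 / 25 * (θBal F.L γ b₀ p₀ (j + 1)) - dist1 (GaugeField.plaqHol U p)) / ((24 / 25 - 1 / 2) * (θBal F.L γ b₀ p₀ (j + 1)))))))))) → (∀ j : ℕ, Ts ≤ j → j < T → μ j = Measure.map (descend F ℰp j) (μ (j + 1)) ∧ μ' j = Measure.map (descend F ℰp j) (μ' (j + 1))) → (∀ j : ℕ, j ≤ T → IsFiniteMeasure (μ j) ∧ IsFiniteMeasure (μ' j)) → (∀ j : ℕ, j₀ ≤ j → j ≤ T → ((∀ U, PlaqSmall (θBal F.L γ b₀ p₀ j) U → 0 < ρ j U ∧ 0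 < ρ' j U) ∧ μ j = (fieldMeasure _ _ _).withDensity (fun U => ENNReal.ofReal (ρ j U)) ∧ μ' j = (fieldMeasure _ _ _).withDensity (fun U => ENNReal.ofReal (ρ' j U)) ∧ (∃ κ : ℝ, MemAtHeight F ℰp j (prm j) (fun U => Real.exp κ * ρ j U)) ∧ (∃ κ : ℝ, MemAtHeight F ℰp j (prm j) (fun U => Real.exp κ * ρ' j U)) ∧ μ j {U | ¬ PlaqSmall (θBal F.L γ b₀ p₀ j) U} ≤ ENNReal.ofReal (η j) ∧ μ' j {U | ¬ PlaqSmall (θBal F.L γ b₀ p₀ j) U} ≤ ENNReal.ofReal (η j) ∧ (ContinuousOn (ρ j) {U | PlaqSmall (θBal F.L γ b₀ p₀ j) U} ∧ ContinuousOn (ρ' j) {U | PlaqSmall (θBal F.L γ b₀ p₀ j) U}) ∧ ((∀ (U : GaugeField _ _ ↥(Matrix.specialUnitaryGroup (Fin 2) ℂ)), PlaqSmall (θBal F.L γ b₀ p₀ j / 2) U → ∀ (b b' : PBond _ _) (v v' : Fin 3 → ℝ), ‖v‖ ≤ 1 → ‖v'‖ ≤ 1 → ∃ g : ℂ × ℂ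 → ℂ, DifferentiableOn ℂ g (Metric.ball (0 : ℂ) (rA * (θBal F.L γ b₀ p₀ j / 2)) ×ˢ Metric.ball (0 : ℂ) (rA * (θBal F.L γ b₀ p₀ j / 2))) ∧ (∀ (s t : ℝ) (V Z : GaugeField _ _ ↥(Matrix.specialUnitaryGroup (Fin 2) ℂ)), |s| < rA * (θBal F.L γ b₀ p₀ j / 2) → |t| < rA * (θBal F.L γ b₀ p₀ j / 2) → (∀ e, e ≠ b → V e = U e) → V b = U b * expPt (s • v) → (∀ e, e ≠ b' → Z e = V e) → Z b' = V b' * expPt (t • v') → g ((s : ℂ), (t : ℂ)) = (((Real.log (ρ j Z)) : ℝ) : ℂ)) ∧ ∀ z ∈ Metric.ball (0 : ℂ) (rA * (θBal F.L γ b₀ p₀ j / 2)) ×ˢ Metric.ball (0 : ℂ) (rA * (θBal F.L γ b₀ p₀ j / 2)), ‖g z - g 0‖ ≤ (Bρ j)) ∧ (∀ (U : GaugeField _ _ ↥(Matrix.specialUnitaryGroup (Fin 2) ℂ)), PlaqSmall (θBal F.L γ b₀ p₀ j / 2) U → ∀ (b b' : PBond _ _) (v v' : Fin 3 → ℝ),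 ‖v‖ ≤ 1 → ‖v'‖ ≤ 1 → ∃ g : ℂ × ℂ → ℂ, DifferentiableOn ℂ g (Metric.ball (0 : ℂ) (rA * (θBal F.L γ b₀ p₀ j / 2)) ×ˢ Metric.ball (0 : ℂ) (rA * (θBal F.L γ b₀ p₀ j / 2))) ∧ (∀ (s t : ℝ) (V Z : GaugeField _ _ ↥(Matrix.specialUnitaryGroup (Fin 2) ℂ)), |s| < rA * (θBal F.L γ b₀ p₀ j / 2) → |t| < rA * (θBal F.L γ b₀ p₀ j / 2) → (∀ e, e ≠ b → V e = U e) → V b = U b * expPt (s • v) → (∀ e, e ≠ b' → Z e = V e) → Z b' = V b' * expPt (t • v') → g ((s : ℂ), (t : ℂ)) = (((Real.log (ρ' j Z)) : ℝ) : ℂ)) ∧ ∀ z ∈ Metric.ball (0 : ℂ) (rA * (θBal F.L γ b₀ p₀ j / 2)) ×ˢ Metric.ball (0 : ℂ) (rA * (θBal F.L γ b₀ p₀ j / 2)), ‖g z - g 0‖ ≤ (Bρ j))))) → ∀ (w : ℝ), 0 ≤ w → w / (((F.L : ℝ) ^ Ts / γ) * θBal F.L γ b₀ p₀ Ts ^ 2)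 ≤ w₀ → (∃ k : PBond (F.P Ts) 0 → PBond (F.P Ts) 0 → ℝ, (∀ b b', 0 ≤ k b b') ∧ (∀ b, ∑ b', k b b' * Real.exp (κ * (b.src.tdist b'.src : ℝ)) ≤ w) ∧ (∀ (b b' : PBond _ _) (v v' : Fin 3 → ℝ) (U V W Z : GaugeField _ _ ↥(Matrix.specialUnitaryGroup (Fin 2) ℂ)), ‖v‖ ≤ (rA / 2) * (θBal F.L γ b₀ p₀ Ts / 4) → ‖v'‖ ≤ (rA / 2) * (θBal F.L γ b₀ p₀ Ts / 4) → PlaqSmall (θBal F.L γ b₀ p₀ Ts / 4) U → PlaqSmall (θBal F.L γ b₀ p₀ Ts / 4) V → PlaqSmall (θBal F.L γ b₀ p₀ Ts / 4) W → PlaqSmall (θBal F.L γ b₀ p₀ Ts / 4) Z → (∀ e, e ≠ b → V e = U e) → V b = U b * expPt v → (∀ e, e ≠ b' → W e = U e) → W b' = U b' * expPt v' → (∀ e, e ≠ b' → Z e = V e) → Z b' = V b' * expPt v' → |(Real.log (ρ Ts Z) - Real.log (ρ' Ts Z)) - (Real.log (ρ Ts V) - Real.log (ρ' Ts V)) - (Real.log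 (ρ Ts W) - Real.log (ρ' Ts W)) + (Real.log (ρ Ts U) - Real.log (ρ' Ts U))| ≤ k b b' * (‖v‖ / (θBal F.L γ b₀ p₀ Ts / 4)) * (‖v'‖ / (θBal F.L γ b₀ p₀ Ts / 4)))) → ∀ (j : ℕ), j₁ ≤ j → j + 1 ≤ Ts → ∃ (c' : Plaq (F.P j) 0 → ℝ) (a' w' : ℝ), 0 ≤ a' ∧ 0 ≤ w' ∧ a' + θ * (w' / (((F.L : ℝ) ^ j / γ) * θBal F.L γ b₀ p₀ j ^ 2)) ≤ (Ctr + εd (T - (Ts + 1)) + C * (w / (((F.L : ℝ) ^ Ts / γ) * θBal F.L γ b₀ p₀ Ts ^ 2))) * (w / (((F.L : ℝ) ^ Ts / γ) * θBal F.L γ b₀ p₀ Ts ^ 2)) + δ j ∧ (∀ p, |c' p| ≤ a') ∧ ∃ k' : PBond (F.P j) 0 → PBond (F.P j) 0 → ℝ, (∀ b b', 0 ≤ k' b b') ∧ (∀ b, ∑ b', k' b b' * Real.exp (κ * (b.src.tdist b'.src : ℝ)) ≤ w') ∧ (∀ (b b' : PBond _ _) (v v' : Fin 3 → ℝ) (U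 V W Z : GaugeField _ _ ↥(Matrix.specialUnitaryGroup (Fin 2) ℂ)), ‖v‖ ≤ r * (θBal F.L γ b₀ p₀ j / 4) → ‖v'‖ ≤ r * (θBal F.L γ b₀ p₀ j / 4) → PlaqSmall (θBal F.L γ b₀ p₀ j / 4) U → PlaqSmall (θBal F.L γ b₀ p₀ j / 4) V → PlaqSmall (θBal F.L γ b₀ p₀ j / 4) W → PlaqSmall (θBal F.L γ b₀ p₀ j / 4) Z → (∀ e, e ≠ b → V e = U e) → V b = U b * expPt v → (∀ e, e ≠ b' → W e = U e) → W b' = U b' * expPt v' → (∀ e, e ≠ b' → Z e = V e) → Z b' = V b' * expPt v' → |(Real.log (ρ j Z) - Real.log (ρ' j Z) - ((F.L : ℝ) ^ j / γ) * ∑ p, c' p * (1 - reTr (GaugeField.plaqHol Z p))) - (Real.log (ρ j V) - Real.log (ρ' j V) - ((F.L : ℝ) ^ j / γ) * ∑ p, c' p * (1 - reTr (GaugeField.plaqHol V p))) - (Real.log (ρ j W) - Real.log (ρ' j W) - ((F.L : ℝ) ^ j / γ) * ∑ p, c' p * (1 - reTr (GaugeField.plaqHol W p))) + (Real.log (ρ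 j U) - Real.log (ρ' j U) - ((F.L : ℝ) ^ j / γ) * ∑ p, c' p * (1 - reTr (GaugeField.plaqHol U p)))| ≤ k' b b' * (‖v‖ / (θBal F.L γ b₀ p₀ j / 4)) * (‖v'‖ / (θBal F.L γ b₀ p₀ j / 4))))) (hPb : (∃ pW : ℝ, ∀ (p₀ : ℝ), pW ≤ p₀ → ∀ (F : T3Family) (γ b₀ : ℝ), 0 < γ → γ ≤ 1 → 0 < b₀ → ∃ jW : ℕ, ∀ j : ℕ, jW ≤ j → ∀ U : GaugeField (F.P j) 0 ↥(Matrix.specialUnitaryGroup (Fin 2) ℂ), PlaqSmall (θBal F.L γ (Real.sqrt b₀) (p₀ / 2) j) U → ∀ δ : ℝ, 0 < δ → ∀ [DecidableEq (PBond (F.P j) 0)], ∃ (u : GaugeTransf (F.P j) 0 ↥(Matrix.specialUnitaryGroup (Fin 2) ℂ)) (path : List (PBond (F.P j) 0 × (Fin 3 → ℝ))), (∀ q ∈ path, ‖q.2‖ ≤ δ) ∧ (∀ b : PBond (F.P j) 0, path.countP (fun q => decide (q.1 = b)) ≤ ⌈1 / (Real.sqrt (θBal F.L γ b₀ p₀ j)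 / 16)⌉₊ * (⌈Real.pi / 2 * (3 * (Real.sqrt (θBal F.L γ b₀ p₀ j) / 16) ^ 2 / 2) / δ⌉₊ + 2)) ∧ List.foldl (fun (W : GaugeField (F.P j) 0 ↥(Matrix.specialUnitaryGroup (Fin 2) ℂ)) (q : PBond (F.P j) 0 × (Fin 3 → ℝ)) => update W q.1 (W q.1 * expPt q.2)) 1 path = GaugeField.gaugeAct u U ∧ (∀ m : ℕ, m ≤ path.length → PlaqSmall (θBal F.L γ b₀ p₀ j) (List.foldl (fun (W : GaugeField (F.P j) 0 ↥(Matrix.specialUnitaryGroup (Fin 2) ℂ)) (q : PBond (F.P j) 0 × (Fin 3 → ℝ)) => update W q.1 (W q.1 * expPt q.2)) 1 (path.take m))) ∧ ∀ m : ℕ, m ≤ path.length → ∀ (b : PBond (F.P j) 0) (w : Fin 3 → ℝ), PlaqSmall (θBal F.L γ b₀ p₀ j + 4 * dist1 (expPt w)) (update (List.foldl (fun (W : GaugeField (F.P j) 0 ↥(Matrix.specialUnitaryGroup (Fin 2) ℂ)) (q : PBond (F.P j) 0 × (Fin 3 → ℝ)) => update W q.1 (W q.1 * expPt q.2)) 1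 (path.take m)) b ((List.foldl (fun (W : GaugeField (F.P j) 0 ↥(Matrix.specialUnitaryGroup (Fin 2) ℂ)) (q : PBond (F.P j) 0 × (Fin 3 → ℝ)) => update W q.1 (W q.1 * expPt q.2)) 1 (path.take m)) b * expPt w)))) : (∃ pW : ℝ, ∃ γ₁ : ℝ, 0 < γ₁ ∧ ∀ (F : T3Family) (γ : ℝ), 0 < γ → γ ≤ γ₁ → ∀ (b₀ p₀ κ : ℝ) (j₀ : ℕ) (prm : ℕ → ClassParams) (η : ℕ → ℝ) (rA : ℝ) (Bρ : ℕ → ℝ), 0 < b₀ → 0 < p₀ → pW ≤ p₀ → AdmissibleClassParams F γ b₀ p₀ prm → 0 < κ → (∀ j, 0 ≤ η j) → Summable η → Summable (fun i => ∑' k, η (k + i)) → Tendsto (fun j => (∑' k, η (k + j)) * ((1 + 2 * ((F.L : ℝ) ^ j / γ) * (Fintype.card (Plaq (F.P j) 0) : ℝ)) * (Fintype.card (PBond (F.P j) 0) : ℝ) ^ 2)) atTop (𝓝 0) → 0 < rA → ∃ (Cs w₀ : ℝ) (δ : ℕ → ℝ) (j₁ : ℕ), 0 ≤ Cs ∧ 0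 < w₀ ∧ (∀ j, 0 ≤ δ j) ∧ Summable δ ∧ Summable (fun i => ∑' k, δ (k + i)) ∧ Tendsto (fun j => (∑' k, δ (k + j)) * ((1 + 2 * ((F.L : ℝ) ^ j / γ) * (Fintype.card (Plaq (F.P j) 0) : ℝ)) * (Fintype.card (PBond (F.P j) 0) : ℝ) ^ 2)) atTop (𝓝 0) ∧ j₀ ≤ j₁ ∧ ∀ (ν : ℕ → (j : ℕ) → MeasureTheory.Measure (GaugeField (F.P j) 0 ↥(Matrix.specialUnitaryGroup (Fin 2) ℂ))), (∀ K, ν K K = T4GenFunBounds.gibbsMeasure (F.P K) ((F.scheme ℰp γ).β K)) → (∀ K j, j < K → ν K j = Measure.map (descend F ℰp j) (ν K (j + 1))) → ∀ (K K' : ℕ), K ≤ K' → ∀ (T Tt : ℕ), T < Tt → Tt ≤ K → ∀ (μ μ' : ((j : ℕ) → MeasureTheory.Measure (GaugeField (F.P j) 0 ↥(Matrix.specialUnitaryGroup (Fin 2) ℂ)))) (ρ ρ' : ((j : ℕ) → GaugeField (F.P j) 0 ↥(Matrix.specialUnitaryGroup (Fin 2) ℂ) → ℝ)), (∀ j : ℕ,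 T ≤ j → j ≤ Tt → μ j = ν K j ∧ μ' j = ν K' j) → (∀ j : ℕ, j < T → μ j = Measure.map (descend F ℰp j) ((μ (j + 1)).withDensity (fun U => ENNReal.ofReal ((∏ p : Plaq _ _, max 0 (min 1 ((24 / 25 * (θBal F.L γ b₀ p₀ (j + 1)) - dist1 (GaugeField.plaqHol U p)) / ((24 / 25 - 1 / 2) * (θBal F.L γ b₀ p₀ (j + 1))))))))) ∧ μ' j = Measure.map (descend F ℰp j) ((μ' (j + 1)).withDensity (fun U => ENNReal.ofReal ((∏ p : Plaq _ _, max 0 (min 1 ((24 / 25 * (θBal F.L γ b₀ p₀ (j + 1)) - dist1 (GaugeField.plaqHol U p)) / ((24 / 25 - 1 / 2) * (θBal F.L γ b₀ p₀ (j + 1)))))))))) → (∀ j : ℕ, T ≤ j → j < Tt → μ j = Measure.map (descend F ℰp j) (μ (j + 1)) ∧ μ' j = Measure.map (descend F ℰp j) (μ' (j + 1))) → (∀ j : ℕ, j ≤ Tt → IsFiniteMeasure (μ j) ∧ IsFiniteMeasure (μ' j)) → (∀ j : ℕ, j₀ ≤ j → j ≤ Tt → ((∀ U, PlaqSmall (θBal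 F.L γ b₀ p₀ j) U → 0 < ρ j U ∧ 0 < ρ' j U) ∧ μ j = (fieldMeasure _ _ _).withDensity (fun U => ENNReal.ofReal (ρ j U)) ∧ μ' j = (fieldMeasure _ _ _).withDensity (fun U => ENNReal.ofReal (ρ' j U)) ∧ (∃ κ : ℝ, MemAtHeight F ℰp j (prm j) (fun U => Real.exp κ * ρ j U)) ∧ (∃ κ : ℝ, MemAtHeight F ℰp j (prm j) (fun U => Real.exp κ * ρ' j U)) ∧ μ j {U | ¬ PlaqSmall (θBal F.L γ b₀ p₀ j) U} ≤ ENNReal.ofReal (η j) ∧ μ' j {U | ¬ PlaqSmall (θBal F.L γ b₀ p₀ j) U} ≤ ENNReal.ofReal (η j) ∧ (ContinuousOn (ρ j) {U | PlaqSmall (θBal F.L γ b₀ p₀ j) U} ∧ ContinuousOn (ρ' j) {U | PlaqSmall (θBal F.L γ b₀ p₀ j) U}) ∧ ((∀ (U : GaugeField _ _ ↥(Matrix.specialUnitaryGroup (Fin 2) ℂ)), PlaqSmall (θBal F.L γ b₀ p₀ j / 2) U → ∀ (b b' : PBond _ _) (v v' : Fin 3 → ℝ), ‖v‖ ≤ 1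 → ‖v'‖ ≤ 1 → ∃ g : ℂ × ℂ → ℂ, DifferentiableOn ℂ g (Metric.ball (0 : ℂ) (rA * (θBal F.L γ b₀ p₀ j / 2)) ×ˢ Metric.ball (0 : ℂ) (rA * (θBal F.L γ b₀ p₀ j / 2))) ∧ (∀ (s t : ℝ) (V Z : GaugeField _ _ ↥(Matrix.specialUnitaryGroup (Fin 2) ℂ)), |s| < rA * (θBal F.L γ b₀ p₀ j / 2) → |t| < rA * (θBal F.L γ b₀ p₀ j / 2) → (∀ e, e ≠ b → V e = U e) → V b = U b * expPt (s • v) → (∀ e, e ≠ b' → Z e = V e) → Z b' = V b' * expPt (t • v') → g ((s : ℂ), (t : ℂ)) = (((Real.log (ρ j Z)) : ℝ) : ℂ)) ∧ ∀ z ∈ Metric.ball (0 : ℂ) (rA * (θBal F.L γ b₀ p₀ j / 2)) ×ˢ Metric.ball (0 : ℂ) (rA * (θBal F.L γ b₀ p₀ j / 2)), ‖g z - g 0‖ ≤ (Bρ j)) ∧ (∀ (U : GaugeField _ _ ↥(Matrix.specialUnitaryGroup (Fin 2) ℂ)), PlaqSmall (θBal F.L γ b₀ p₀ j / 2) U → ∀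 (b b' : PBond _ _) (v v' : Fin 3 → ℝ), ‖v‖ ≤ 1 → ‖v'‖ ≤ 1 → ∃ g : ℂ × ℂ → ℂ, DifferentiableOn ℂ g (Metric.ball (0 : ℂ) (rA * (θBal F.L γ b₀ p₀ j / 2)) ×ˢ Metric.ball (0 : ℂ) (rA * (θBal F.L γ b₀ p₀ j / 2))) ∧ (∀ (s t : ℝ) (V Z : GaugeField _ _ ↥(Matrix.specialUnitaryGroup (Fin 2) ℂ)), |s| < rA * (θBal F.L γ b₀ p₀ j / 2) → |t| < rA * (θBal F.L γ b₀ p₀ j / 2) → (∀ e, e ≠ b → V e = U e) → V b = U b * expPt (s • v) → (∀ e, e ≠ b' → Z e = V e) → Z b' = V b' * expPt (t • v') → g ((s : ℂ), (t : ℂ)) = (((Real.log (ρ' j Z)) : ℝ) : ℂ)) ∧ ∀ z ∈ Metric.ball (0 : ℂ) (rA * (θBal F.L γ b₀ p₀ j / 2)) ×ˢ Metric.ball (0 : ℂ) (rA * (θBal F.L γ b₀ p₀ j / 2)), ‖g z - g 0‖ ≤ (Bρ j))))) → ∀ (wT : ℝ), 0 ≤ wT → wT / (((F.L : ℝ) ^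 T / γ) * θBal F.L γ b₀ p₀ T ^ 2) ≤ w₀ → (∃ kT : PBond (F.P T) 0 → PBond (F.P T) 0 → ℝ, (∀ b b', 0 ≤ kT b b') ∧ (∀ b, ∑ b', kT b b' * Real.exp (κ * (b.src.tdist b'.src : ℝ)) ≤ wT) ∧ (∀ (b b' : PBond _ _) (v v' : Fin 3 → ℝ) (U V W Z : GaugeField _ _ ↥(Matrix.specialUnitaryGroup (Fin 2) ℂ)), ‖v‖ ≤ (rA / 2) * (θBal F.L γ b₀ p₀ T / 4) → ‖v'‖ ≤ (rA / 2) * (θBal F.L γ b₀ p₀ T / 4) → PlaqSmall (θBal F.L γ b₀ p₀ T / 4) U → PlaqSmall (θBal F.L γ b₀ p₀ T / 4) V → PlaqSmall (θBal F.L γ b₀ p₀ T / 4) W → PlaqSmall (θBal F.L γ b₀ p₀ T / 4) Z → (∀ e, e ≠ b → V e = U e) → V b = U b * expPt v → (∀ e, e ≠ b' → W e = U e) → W b' = U b' * expPt v' → (∀ e, e ≠ b' → Z e = V e) → Z b' = V b' * expPt v' → |(Real.log (ρ T Z) - Real.log (ρ' T Z)) - (Real.log (ρ T V) - Real.log (ρ'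 T V)) - (Real.log (ρ T W) - Real.log (ρ' T W)) + (Real.log (ρ T U) - Real.log (ρ' T U))| ≤ kT b b' * (‖v‖ / (θBal F.L γ b₀ p₀ T / 4)) * (‖v'‖ / (θBal F.L γ b₀ p₀ T / 4)))) → ∀ (j : ℕ), j₁ ≤ j → j ≤ T → ∀ U : GaugeField (F.P j) 0 ↥(Matrix.specialUnitaryGroup (Fin 2) ℂ), PlaqSmall (θBal F.L γ (Real.sqrt (b₀ / 8)) (p₀ / 2) j) U → |(Real.log (ρ j U) - Real.log (ρ' j U)) - (Real.log (ρ j 1) - Real.log (ρ' j 1))| ≤ (Cs * (wT / (((F.L : ℝ) ^ T / γ) * θBal F.L γ b₀ p₀ T ^ 2)) + δ j) * (((F.L : ℝ) ^ j / γ) * (2 * (Fintype.card (Plaq (F.P j) 0) : ℝ) + (Fintype.card (PBond (F.P j) 0) : ℝ) ^ 2))) := by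
  classical
  obtain ⟨pW, hPW⟩ := hPb
  obtain ⟨γ₁, hγ₁, HO⟩ := hO
  refine ⟨pW, min γ₁ 1, lt_min hγ₁ one_pos, ?_⟩
  intro F γ hγ hγle b₀ p₀ κ j₀ prm η rA Bρ hb₀ hp₀ hpW hadm hκ hη0 hηs hηt hηT hrA
  have hγ₁' : γ ≤ γ₁ := hγle.trans (min_le_left _ _)
  have hγ1 : γ ≤ 1 := hγle.trans (min_le_right _ _)
  obtain ⟨κ₀, hκ₀, HO1⟩ := HO F γ hγ hγ₁' b₀ p₀ j₀ prm η rA Bρ hb₀ hp₀ hadm hη0 hηs hηt hηT hrA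
  have hκ'0 : 0 < min κ κ₀ := lt_min hκ hκ₀
  obtain ⟨θ, r, Ctr, C, w₀, εd, δ, j₁, hθ, hr, hCtr, hC, hw₀, hεδ, hεs, hδs, hδt, hδT, hj₀₁, HO2⟩ :=
    HO1 (min κ κ₀) hκ'0 (min_le_right _ _)
  -- (P-b′) at path profile `b₀∕8`
  obtain ⟨jW, HPb⟩ := hPW p₀ hpW F γ (b₀ / 8) hγ hγ1 (by positivity)
  -- `θ_j ≤ 1` eventually
  obtain ⟨jθ, hjθ⟩ : ∃ jθ : ℕ, ∀ j, jθ ≤ j → θBal F.L γ b₀ p₀ j ≤ 1 := by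
    have ht := T3ThresholdSmallness.tendsto_θBal_atTop F.hL.2 hγ b₀ p₀
    obtain ⟨jθ, hj⟩ := Filter.eventually_atTop.1 (ht.eventually (Iio_mem_nhds one_pos))
    exact ⟨jθ, fun j hj' => (Set.mem_Iio.1 (hj j hj')).le⟩
  -- constants
  have hεdE : ∀ i, εd i ≤ ∑' i, εd i := fun i => hεs.le_tsum i (fun k _ => (hεδ k).1)
  obtain ⟨M, hM⟩ : ∃ M : ℝ, M = 150 / θ + 150 := ⟨_, rfl⟩
  have hMθ : 0 ≤ 150 / θ := by positivity
  have hM0 : 0 ≤ M := by rw [hM]; linarith only [hMθ]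
  have hE0 : 0 ≤ ∑' i, εd i := tsum_nonneg fun i => (hεδ i).1
  have hCw : 0 ≤ C * w₀ := by positivity
  obtain ⟨A, hA⟩ : ∃ A : ℝ, A = Ctr + ∑' i, εd i + C * w₀ := ⟨_, rfl⟩
  have hA1 : 1 ≤ A := by rw [hA]; linarith only [hCtr, hE0, hCw]
  have hMA0 : 0 ≤ M * A := mul_nonneg hM0 (zero_le_one.trans hA1)
  have htails : Summable (fun i => ∑' k, M * δ (k + i)) := by
    simp_rw [tsum_mul_left]; exact hδt.mul_left M
  have htend : Tendsto (fun j => (∑' k, M * δ (k + j)) * ((1 + 2 * ((F.L : ℝ) ^ j / γ) * (Fintype.card (Plaq (F.P j) 0) : ℝ)) *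
      (Fintype.card (PBond (F.P j) 0) : ℝ) ^ 2)) atTop (𝓝 0) := by
    have hfun : (fun j => (∑' k, M * δ (k + j)) * ((1 + 2 * ((F.L : ℝ) ^ j / γ) * (Fintype.card (Plaq (F.P j) 0) : ℝ)) *
        (Fintype.card (PBond (F.P j) 0) : ℝ) ^ 2))
        = fun j => M * ((∑' k, δ (k + j)) * ((1 + 2 * ((F.L : ℝ) ^ j / γ) * (Fintype.card (Plaq (F.P j) 0) : ℝ)) *
          (Fintype.card (PBond (F.P j) 0) : ℝ) ^ 2)) := by
      funext j; rw [tsum_mul_left]; ring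
    rw [hfun]; simpa using hδT.const_mul M
  refine ⟨M * A, w₀, fun j => M * δ j, max j₁ (max jW jθ), hMA0, hw₀, fun j => mul_nonneg hM0 (hεδ j).2,
    hδs.mul_left M, htails, htend, hj₀₁.trans (le_max_left _ _), ?_⟩
  intro ν hν1 hν2 K K' hKK' T Tt hTTt hTtK μ μ' ρ ρ' hruns hcut hcons hfin h8 wT hwT hxT hseed j hj₁ hjT U hU
  have hj₁' : j₁ ≤ j := (le_max_left _ _).trans hj₁
  have hjW : jW ≤ j := ((le_max_left _ _).trans (le_max_right _ _)).trans hj₁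
  have hjθ' : jθ ≤ j := ((le_max_right _ _).trans (le_max_right _ _)).trans hj₁
  have hθj1 : θBal F.L γ b₀ p₀ j ≤ 1 := hjθ j hjθ'
  have hθj : 0 < θBal F.L γ b₀ p₀ j := T3MinimiserStabilityReduction.θBal_pos F.hL.2.le hγ hγ1 hb₀ p₀ j
  have hL0 : (0 : ℝ) < F.L := by exact_mod_cast (zero_lt_one.trans F.hL.2)
  have hβj0 : 0 < (F.L : ℝ) ^ j / γ := by positivity
  have hNP : (0 : ℝ) ≤ (Fintype.card (Plaq (F.P j) 0) : ℝ) := Nat.cast_nonneg _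
  -- block ⑧ at `j`: the regular-class memberships (for gauge invariance)
  have hjTt : j ≤ Tt := hjT.trans hTTt.le
  obtain ⟨-, -, -, h8ρ, h8ρ', -⟩ := h8 j (hj₀₁.trans hj₁') hjTt
  -- step size
  set σ : ℝ := min (min r (rA / 2)) (1 / 16) with hσ
  have hσ0 : 0 < σ := lt_min (lt_min hr (half_pos hrA)) (by norm_num)
  have hσr : σ ≤ r := (min_le_left _ _).trans (min_le_left _ _)
  have hσA : σ ≤ rA / 2 := (min_le_left _ _).trans (min_le_right _ _)
  have hσ1 : σ ≤ 1 / 16 := min_le_right _ _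
  -- (P-b′)'s path for `U`
  obtain ⟨u, path, hszP, hcountP, hendP, hpreP, hexcP⟩ := HPb j hjW U hU (σ * (θBal F.L γ b₀ p₀ j / 4)) (by positivity)
  rcases Nat.lt_or_ge j T with hjlt | hjge
  · /- `j < T`: O1ᵘ-H v2's direct transport from the seed -/
    obtain ⟨kT, hkT0, hkTrow, hkTcl⟩ := hseed
    have hseed' : ∃ k : PBond (F.P T) 0 → PBond (F.P T) 0 → ℝ, (∀ b b', 0 ≤ k b b') ∧
        (∀ b, ∑ b', k b b' * Real.exp (min κ κ₀ * (b.src.tdist b'.src : ℝ)) ≤ wT) ∧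
        (∀ (b b' : PBond _ _) (v v' : Fin 3 → ℝ) (U V W Z : GaugeField _ _ ↥(Matrix.specialUnitaryGroup (Fin 2) ℂ)), ‖v‖ ≤ (rA / 2) * (θBal F.L γ b₀ p₀ T / 4) → ‖v'‖ ≤ (rA / 2) * (θBal F.L γ b₀ p₀ T / 4) → PlaqSmall (θBal F.L γ b₀ p₀ T / 4) U → PlaqSmall (θBal F.L γ b₀ p₀ T / 4) V → PlaqSmall (θBal F.L γ b₀ p₀ T / 4) W → PlaqSmall (θBal F.L γ b₀ p₀ T / 4) Z → (∀ e, e ≠ b → V e = U e) → V b = U b * expPt v → (∀ e, e ≠ b' → W e = U e) → W b' = U b' * expPt v' → (∀ e, e ≠ b' → Z e = V e) → Z b' = V b' * expPt v' → |(Real.log (ρ T Z) - Real.log (ρ' T Z)) - (Real.log (ρ T V) - Real.log (ρ' T V)) - (Real.log (ρ T W) - Real.log (ρ' T W)) + (Real.log (ρ T U) - Real.log (ρ' T U))| ≤ k b b' * (‖v‖ / (θBal F.L γ b₀ p₀ T / 4)) * (‖v'‖ / (θBal F.L γ b₀ p₀ T / 4))) :=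
      ⟨kT, hkT0, fun b => rowMass_mono (min_le_left _ _) hkT0 hkTrow b, hkTcl⟩
    obtain ⟨c', a', w', ha', hw', hY, hc', k', hk'0, hk'row, hk'cl⟩ :=
      HO2 ν hν1 hν2 K K' hKK' T Tt hTTt hTtK μ μ' ρ ρ' hruns hcut hcons hfin h8 wT hwT hxT hseed' j hj₁' (by omega)
    have hkK : ∀ b b', 0 ≤ k' b b' ∧ k' b b' ≤ w' := fun b b' => ⟨hk'0 b b', letter_le_rowMass hκ'0.le hk'0 hk'row b b'⟩
    have hinv : GaugeField.GaugeInvariant (fun U : GaugeField (F.P j) 0 SU2 =>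
        Real.log (ρ j U) - Real.log (ρ' j U) - ((F.L : ℝ) ^ j / γ) * ∑ p, c' p * (1 - reTr (GaugeField.plaqHol U p))) :=
      Summit.QuantumFields.YangMills.Theorems.OrganTangentWindowGaugeInvariance.gaugeInvariant_organDiscrepancy F h8ρ h8ρ' _ c'
    have hcore := supOsc_core hθj hθj1 hw' hσ0 hσr hσ1 hkK hk'cl hinv U u path hszP hcountP hendP hpreP hexcP
    -- the marginal at `U` and at `1`
    have hmargU : |((F.L : ℝ) ^ j / γ) * ∑ p, c' p * (1 - reTr (GaugeField.plaqHol U p))| ≤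
        ((F.L : ℝ) ^ j / γ) * (2 * (Fintype.card (Plaq (F.P j) 0) : ℝ)) * a' := by
      rw [abs_mul, abs_of_pos hβj0, mul_assoc]
      refine mul_le_mul_of_nonneg_left ?_ hβj0.le
      calc |∑ p, c' p * (1 - reTr (GaugeField.plaqHol U p))| ≤ ∑ p, |c' p * (1 - reTr (GaugeField.plaqHol U p))| :=
            Finset.abs_sum_le_sum_abs _ _
        _ ≤ ∑ _p : Plaq (F.P j) 0, a' * 2 := Finset.sum_le_sum fun p _ => by
            rw [abs_mul]
            have h12 := RegularGaugeGroup.one_sub_reTr_mem_Icc (GaugeField.plaqHol U p)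
            exact mul_le_mul (hc' p) (abs_le.2 ⟨by linarith [h12.1], h12.2⟩) (abs_nonneg _) ((abs_nonneg _).trans (hc' p))
        _ = 2 * (Fintype.card (Plaq (F.P j) 0) : ℝ) * a' := by rw [Finset.sum_const, nsmul_eq_mul, Finset.card_univ]; ring
    have hmarg1 : (∑ p, c' p * (1 - reTr (GaugeField.plaqHol (1 : GaugeField (F.P j) 0 SU2) p))) = 0 := by
      simp [T4SmallFieldWindowSandwich.plaqHol_one, GaugeGroup.reTr_one]
    -- sizes from the output budget
    have hD : 0 < ((F.L : ℝ) ^ j / γ) * θBal F.L γ b₀ p₀ j ^ 2 := by positivity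
    have hwY : θ * w' ≤ ((Ctr + εd (Tt - (T + 1)) + C * (wT / (((F.L : ℝ) ^ T / γ) * θBal F.L γ b₀ p₀ T ^ 2))) *
        (wT / (((F.L : ℝ) ^ T / γ) * θBal F.L γ b₀ p₀ T ^ 2)) + δ j) * (((F.L : ℝ) ^ j / γ) * θBal F.L γ b₀ p₀ j ^ 2) := by
      have h1 : θ * (w' / (((F.L : ℝ) ^ j / γ) * θBal F.L γ b₀ p₀ j ^ 2)) ≤ _ := le_trans (by linarith only [ha']) hY
      rwa [mul_div_assoc', div_le_iff₀ hD] at h1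
    have haY : a' ≤ (Ctr + εd (Tt - (T + 1)) + C * (wT / (((F.L : ℝ) ^ T / γ) * θBal F.L γ b₀ p₀ T ^ 2))) *
        (wT / (((F.L : ℝ) ^ T / γ) * θBal F.L γ b₀ p₀ T ^ 2)) + δ j := by
      have : 0 ≤ θ * (w' / (((F.L : ℝ) ^ j / γ) * θBal F.L γ b₀ p₀ j ^ 2)) := by positivity
      linarith only [this, hY]
    have hYA : (Ctr + εd (Tt - (T + 1)) + C * (wT / (((F.L : ℝ) ^ T / γ) * θBal F.L γ b₀ p₀ T ^ 2))) *
        (wT / (((F.L : ℝ) ^ T / γ) * θBal F.L γ b₀ p₀ T ^ 2)) + δ j ≤ A * (wT / (((F.L : ℝ) ^ T / γ) * θBal F.L γ b₀ p₀ T ^ 2)) + δ j := by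
      have h1 : εd (Tt - (T + 1)) ≤ ∑' i, εd i := hεdE _
      have h2 : C * (wT / (((F.L : ℝ) ^ T / γ) * θBal F.L γ b₀ p₀ T ^ 2)) ≤ C * w₀ := mul_le_mul_of_nonneg_left hxT hC
      have h0 : 0 ≤ wT / (((F.L : ℝ) ^ T / γ) * θBal F.L γ b₀ p₀ T ^ 2) := by positivity
      have h3 : Ctr + εd (Tt - (T + 1)) + C * (wT / (((F.L : ℝ) ^ T / γ) * θBal F.L γ b₀ p₀ T ^ 2)) ≤ A := by
        rw [hA]; linarith only [h1, h2]
      exact add_le_add (mul_le_mul_of_nonneg_right h3 h0) le_rfl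
    -- conclude
    have hdec : (Real.log (ρ j U) - Real.log (ρ' j U)) - (Real.log (ρ j 1) - Real.log (ρ' j 1))
        = ((Real.log (ρ j U) - Real.log (ρ' j U) - ((F.L : ℝ) ^ j / γ) * ∑ p, c' p * (1 - reTr (GaugeField.plaqHol U p))) -
            (Real.log (ρ j 1) - Real.log (ρ' j 1) - ((F.L : ℝ) ^ j / γ) *
              ∑ p, c' p * (1 - reTr (GaugeField.plaqHol (1 : GaugeField (F.P j) 0 SU2) p)))) +
          ((F.L : ℝ) ^ j / γ) * ∑ p, c' p * (1 - reTr (GaugeField.plaqHol U p)) := by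
      rw [hmarg1]; ring
    rw [hdec]
    exact (abs_add_le _ _).trans (assemble_lt hθ hM hβj0 hθj hθj1 hNP ha' haY hwY hYA hcore hmargU)
  · /- `j = T`: the seed clause itself -/
    obtain rfl : j = T := le_antisymm hjT hjge
    obtain ⟨kT, hkT0, hkTrow, hkTcl⟩ := hseed
    have hkK : ∀ b b', 0 ≤ kT b b' ∧ kT b b' ≤ wT := fun b b' => ⟨hkT0 b b', letter_le_rowMass hκ.le hkT0 hkTrow b b'⟩
    have hinv : GaugeField.GaugeInvariant (fun U : GaugeField (F.P j) 0 SU2 => Real.log (ρ j U) - Real.log (ρ' j U)) :=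
      Summit.QuantumFields.YangMills.Theorems.OrganTangentWindowGaugeInvariance.gaugeInvariant_organLogRatio F h8ρ h8ρ'
    have hcore := supOsc_core hθj hθj1 hwT hσ0 hσA hσ1 hkK hkTcl hinv U u path hszP hcountP hendP hpreP hexcP
    have hpos : 0 < ((F.L : ℝ) ^ j / γ) * θBal F.L γ b₀ p₀ j ^ 2 := by positivity
    have hwx : wT = wT / (((F.L : ℝ) ^ j / γ) * θBal F.L γ b₀ p₀ j ^ 2) * (((F.L : ℝ) ^ j / γ) * θBal F.L γ b₀ p₀ j ^ 2) := by
      rw [div_mul_cancel₀ _ hpos.ne']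
    exact assemble_eq hθ hM hA1 (hεδ j).2 (by positivity) hβj0 hθj hθj1 hNP hwx hcore

/-! ## §F (v1.1) (P-b′) BY NAME — the hypothesis `(∃ pW : ℝ, ∀ (p₀ : ℝ), pW ≤ p₀ → ∀ (F : T3Family) (γ b₀ : ℝ), 0 < γ → γ ≤ 1 → 0 < b₀ → ∃ jW : ℕ, ∀ j : ℕ, jW ≤ j → ∀ U : GaugeField (F.P j) 0 ↥(Matrix.specialUnitaryGroup (Fin 2) ℂ), PlaqSmall (θBal F.L γ (Real.sqrt b₀) (p₀ / 2) j) U → ∀ δ : ℝ, 0 < δ → ∀ [DecidableEq (PBond (F.P j) 0)], ∃ (u : GaugeTransf (F.P j) 0 ↥(Matrix.specialUnitaryGroup (Fin 2) ℂ)) (path : List (PBond (F.P j) 0 × (Fin 3 → ℝ))), (∀ q ∈ path, ‖q.2‖ ≤ δ) ∧ (∀ b : PBond (F.P j) 0, path.countP (fun q => decide (q.1 = b)) ≤ ⌈1 / (Real.sqrt (θBal F.L γ b₀ p₀ j) / 16)⌉₊ * (⌈Real.pi / 2 * (3 * (Real.sqrt (θBal F.L γ b₀ p₀ j) / 16) ^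 2 / 2) / δ⌉₊ + 2)) ∧ List.foldl (fun (W : GaugeField (F.P j) 0 ↥(Matrix.specialUnitaryGroup (Fin 2) ℂ)) (q : PBond (F.P j) 0 × (Fin 3 → ℝ)) => update W q.1 (W q.1 * expPt q.2)) 1 path = GaugeField.gaugeAct u U ∧ (∀ m : ℕ, m ≤ path.length → PlaqSmall (θBal F.L γ b₀ p₀ j) (List.foldl (fun (W : GaugeField (F.P j) 0 ↥(Matrix.specialUnitaryGroup (Fin 2) ℂ)) (q : PBond (F.P j) 0 × (Fin 3 → ℝ)) => update W q.1 (W q.1 * expPt q.2)) 1 (path.take m))) ∧ ∀ m : ℕ, m ≤ path.length → ∀ (b : PBond (F.P j) 0) (w : Fin 3 → ℝ), PlaqSmall (θBal F.L γ b₀ p₀ j + 4 * dist1 (expPt w)) (update (List.foldl (fun (W : GaugeField (F.P j) 0 ↥(Matrix.specialUnitaryGroup (Fin 2) ℂ)) (q : PBond (F.P j) 0 × (Fin 3 → ℝ)) => update W q.1 (W q.1 * expPt q.2)) 1 (path.take m)) b ((List.foldl (fun (W : GaugeField (F.P j) 0 ↥(Matrix.specialUnitaryGroup (Fin 2) ℂ))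 (q : PBond (F.P j) 0 × (Fin 3 → ℝ)) => update W q.1 (W q.1 * expPt q.2)) 1 (path.take m)) b * expPt w)))` is ✓ `OrganTangentSmallStepChordPath.exists_smallStep_chordPath_gaugeCopy`
(w4 g22, tree sha16 a71eeaf6fcbd4dbe), so the junction reads: O1ᵘ-H v2 ALONE ⟹ S3ᴴ. -/


/-- ★ THE JUNCTION, final form: the H-currency direct-transport organ O1ᵘ-H v2 gives the derived finite-run organ S3ᴴ (sup-oscillation
on the inner window), kernel-checked, no `sorry`; O1ᵘ-H v2 itself is an O-class HYPOTHESIS (not proved here or anywhere in the tree). -/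
theorem backwardStabilityFinSupH_of_oneStepTransportUH (hO : (∃ γ₁ : ℝ, 0 < γ₁ ∧ ∀ (F : T3Family) (γ : ℝ), 0 < γ → γ ≤ γ₁ → ∀ (b₀ p₀ : ℝ) (j₀ : ℕ) (prm : ℕ → ClassParams) (η : ℕ → ℝ) (rA : ℝ) (Bρ : ℕ → ℝ), 0 < b₀ → 0 < p₀ → AdmissibleClassParams F γ b₀ p₀ prm → (∀ j, 0 ≤ η j) → Summable η → Summable (fun i => ∑' k, η (k + i)) → Tendsto (fun j => (∑' k, η (k + j)) * ((1 + 2 * ((F.L : ℝ) ^ j / γ) * (Fintype.card (Plaq (F.P j) 0) : ℝ)) * (Fintype.card (PBond (F.P j) 0) : ℝ) ^ 2)) atTop (𝓝 0) → 0 < rA → ∃ κ₀ : ℝ, 0 < κ₀ ∧ ∀ (κ : ℝ), 0 < κ → κ ≤ κ₀ → ∃ (θ r Ctr C w₀ : ℝ) (εd δ : ℕ → ℝ) (j₁ : ℕ), 0 < θ ∧ 0 < r ∧ 1 ≤ Ctr ∧ 0 ≤ C ∧ 0 < w₀ ∧ (∀ j, 0 ≤ εd j ∧ 0 ≤ δ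 j) ∧ Summable εd ∧ Summable δ ∧ Summable (fun i => ∑' k, δ (k + i)) ∧ Tendsto (fun j => (∑' k, δ (k + j)) * ((1 + 2 * ((F.L : ℝ) ^ j / γ) * (Fintype.card (Plaq (F.P j) 0) : ℝ)) * (Fintype.card (PBond (F.P j) 0) : ℝ) ^ 2)) atTop (𝓝 0) ∧ j₀ ≤ j₁ ∧ ∀ (ν : ℕ → (j : ℕ) → MeasureTheory.Measure (GaugeField (F.P j) 0 ↥(Matrix.specialUnitaryGroup (Fin 2) ℂ))), (∀ K, ν K K = T4GenFunBounds.gibbsMeasure (F.P K) ((F.scheme ℰp γ).β K)) → (∀ K j, j < K → ν K j = Measure.map (descend F ℰp j) (ν K (j + 1))) → ∀ (K K' : ℕ), K ≤ K' → ∀ (Ts T : ℕ), Ts < T → T ≤ K → ∀ (μ μ' : ((j : ℕ) → MeasureTheory.Measure (GaugeField (F.P j) 0 ↥(Matrix.specialUnitaryGroup (Fin 2) ℂ)))) (ρ ρ' : ((j : ℕ) → GaugeField (F.P j) 0 ↥(Matrix.specialUnitaryGroup (Fin 2) ℂ) → ℝ)), (∀ j : ℕ, Ts ≤ j → j ≤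 T → μ j = ν K j ∧ μ' j = ν K' j) → (∀ j : ℕ, j < Ts → μ j = Measure.map (descend F ℰp j) ((μ (j + 1)).withDensity (fun U => ENNReal.ofReal ((∏ p : Plaq _ _, max 0 (min 1 ((24 / 25 * (θBal F.L γ b₀ p₀ (j + 1)) - dist1 (GaugeField.plaqHol U p)) / ((24 / 25 - 1 / 2) * (θBal F.L γ b₀ p₀ (j + 1))))))))) ∧ μ' j = Measure.map (descend F ℰp j) ((μ' (j + 1)).withDensity (fun U => ENNReal.ofReal ((∏ p : Plaq _ _, max 0 (min 1 ((24 / 25 * (θBal F.L γ b₀ p₀ (j + 1)) - dist1 (GaugeField.plaqHol U p)) / ((24 / 25 - 1 / 2) * (θBal F.L γ b₀ p₀ (j + 1)))))))))) → (∀ j : ℕ, Ts ≤ j → j < T → μ j = Measure.map (descend F ℰp j) (μ (j + 1)) ∧ μ' j = Measure.map (descend F ℰp j) (μ' (j + 1))) → (∀ j : ℕ, j ≤ T → IsFiniteMeasure (μ j) ∧ IsFiniteMeasure (μ' j)) → (∀ j : ℕ, j₀ ≤ j → j ≤ T → ((∀ U, PlaqSmall (θBal F.L γ b₀ p₀ j)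 U → 0 < ρ j U ∧ 0 < ρ' j U) ∧ μ j = (fieldMeasure _ _ _).withDensity (fun U => ENNReal.ofReal (ρ j U)) ∧ μ' j = (fieldMeasure _ _ _).withDensity (fun U => ENNReal.ofReal (ρ' j U)) ∧ (∃ κ : ℝ, MemAtHeight F ℰp j (prm j) (fun U => Real.exp κ * ρ j U)) ∧ (∃ κ : ℝ, MemAtHeight F ℰp j (prm j) (fun U => Real.exp κ * ρ' j U)) ∧ μ j {U | ¬ PlaqSmall (θBal F.L γ b₀ p₀ j) U} ≤ ENNReal.ofReal (η j) ∧ μ' j {U | ¬ PlaqSmall (θBal F.L γ b₀ p₀ j) U} ≤ ENNReal.ofReal (η j) ∧ (ContinuousOn (ρ j) {U | PlaqSmall (θBal F.L γ b₀ p₀ j) U} ∧ ContinuousOn (ρ' j) {U | PlaqSmall (θBal F.L γ b₀ p₀ j) U}) ∧ ((∀ (U : GaugeField _ _ ↥(Matrix.specialUnitaryGroup (Fin 2) ℂ)), PlaqSmall (θBal F.L γ b₀ p₀ j / 2) U → ∀ (b b' : PBond _ _) (v v' : Fin 3 → ℝ), ‖v‖ ≤ 1 → ‖v'‖ ≤ 1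 → ∃ g : ℂ × ℂ → ℂ, DifferentiableOn ℂ g (Metric.ball (0 : ℂ) (rA * (θBal F.L γ b₀ p₀ j / 2)) ×ˢ Metric.ball (0 : ℂ) (rA * (θBal F.L γ b₀ p₀ j / 2))) ∧ (∀ (s t : ℝ) (V Z : GaugeField _ _ ↥(Matrix.specialUnitaryGroup (Fin 2) ℂ)), |s| < rA * (θBal F.L γ b₀ p₀ j / 2) → |t| < rA * (θBal F.L γ b₀ p₀ j / 2) → (∀ e, e ≠ b → V e = U e) → V b = U b * expPt (s • v) → (∀ e, e ≠ b' → Z e = V e) → Z b' = V b' * expPt (t • v') → g ((s : ℂ), (t : ℂ)) = (((Real.log (ρ j Z)) : ℝ) : ℂ)) ∧ ∀ z ∈ Metric.ball (0 : ℂ) (rA * (θBal F.L γ b₀ p₀ j / 2)) ×ˢ Metric.ball (0 : ℂ) (rA * (θBal F.L γ b₀ p₀ j / 2)), ‖g z - g 0‖ ≤ (Bρ j)) ∧ (∀ (U : GaugeField _ _ ↥(Matrix.specialUnitaryGroup (Fin 2) ℂ)), PlaqSmall (θBal F.L γ b₀ p₀ j / 2) U → ∀ (b b' : PBond _ _) (v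 v' : Fin 3 → ℝ), ‖v‖ ≤ 1 → ‖v'‖ ≤ 1 → ∃ g : ℂ × ℂ → ℂ, DifferentiableOn ℂ g (Metric.ball (0 : ℂ) (rA * (θBal F.L γ b₀ p₀ j / 2)) ×ˢ Metric.ball (0 : ℂ) (rA * (θBal F.L γ b₀ p₀ j / 2))) ∧ (∀ (s t : ℝ) (V Z : GaugeField _ _ ↥(Matrix.specialUnitaryGroup (Fin 2) ℂ)), |s| < rA * (θBal F.L γ b₀ p₀ j / 2) → |t| < rA * (θBal F.L γ b₀ p₀ j / 2) → (∀ e, e ≠ b → V e = U e) → V b = U b * expPt (s • v) → (∀ e, e ≠ b' → Z e = V e) → Z b' = V b' * expPt (t • v') → g ((s : ℂ), (t : ℂ)) = (((Real.log (ρ' j Z)) : ℝ) : ℂ)) ∧ ∀ z ∈ Metric.ball (0 : ℂ) (rA * (θBal F.L γ b₀ p₀ j / 2)) ×ˢ Metric.ball (0 : ℂ) (rA * (θBal F.L γ b₀ p₀ j / 2)), ‖g z - g 0‖ ≤ (Bρ j))))) → ∀ (w : ℝ), 0 ≤ w → w / (((F.L : ℝ) ^ Ts / γ) * θBal F.L γ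 b₀ p₀ Ts ^ 2) ≤ w₀ → (∃ k : PBond (F.P Ts) 0 → PBond (F.P Ts) 0 → ℝ, (∀ b b', 0 ≤ k b b') ∧ (∀ b, ∑ b', k b b' * Real.exp (κ * (b.src.tdist b'.src : ℝ)) ≤ w) ∧ (∀ (b b' : PBond _ _) (v v' : Fin 3 → ℝ) (U V W Z : GaugeField _ _ ↥(Matrix.specialUnitaryGroup (Fin 2) ℂ)), ‖v‖ ≤ (rA / 2) * (θBal F.L γ b₀ p₀ Ts / 4) → ‖v'‖ ≤ (rA / 2) * (θBal F.L γ b₀ p₀ Ts / 4) → PlaqSmall (θBal F.L γ b₀ p₀ Ts / 4) U → PlaqSmall (θBal F.L γ b₀ p₀ Ts / 4) V → PlaqSmall (θBal F.L γ b₀ p₀ Ts / 4) W → PlaqSmall (θBal F.L γ b₀ p₀ Ts / 4) Z → (∀ e, e ≠ b → V e = U e) → V b = U b * expPt v → (∀ e, e ≠ b' → W e = U e) → W b' = U b' * expPt v' → (∀ e, e ≠ b' → Z e = V e) → Z b' = V b' * expPt v' → |(Real.log (ρ Ts Z) - Real.log (ρ' Ts Z)) - (Real.log (ρ Ts V) -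 Real.log (ρ' Ts V)) - (Real.log (ρ Ts W) - Real.log (ρ' Ts W)) + (Real.log (ρ Ts U) - Real.log (ρ' Ts U))| ≤ k b b' * (‖v‖ / (θBal F.L γ b₀ p₀ Ts / 4)) * (‖v'‖ / (θBal F.L γ b₀ p₀ Ts / 4)))) → ∀ (j : ℕ), j₁ ≤ j → j + 1 ≤ Ts → ∃ (c' : Plaq (F.P j) 0 → ℝ) (a' w' : ℝ), 0 ≤ a' ∧ 0 ≤ w' ∧ a' + θ * (w' / (((F.L : ℝ) ^ j / γ) * θBal F.L γ b₀ p₀ j ^ 2)) ≤ (Ctr + εd (T - (Ts + 1)) + C * (w / (((F.L : ℝ) ^ Ts / γ) * θBal F.L γ b₀ p₀ Ts ^ 2))) * (w / (((F.L : ℝ) ^ Ts / γ) * θBal F.L γ b₀ p₀ Ts ^ 2)) + δ j ∧ (∀ p, |c' p| ≤ a') ∧ ∃ k' : PBond (F.P j) 0 → PBond (F.P j) 0 → ℝ, (∀ b b', 0 ≤ k' b b') ∧ (∀ b, ∑ b', k' b b' * Real.exp (κ * (b.src.tdist b'.src : ℝ)) ≤ w') ∧ (∀ (b b' : PBond _ _)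 (v v' : Fin 3 → ℝ) (U V W Z : GaugeField _ _ ↥(Matrix.specialUnitaryGroup (Fin 2) ℂ)), ‖v‖ ≤ r * (θBal F.L γ b₀ p₀ j / 4) → ‖v'‖ ≤ r * (θBal F.L γ b₀ p₀ j / 4) → PlaqSmall (θBal F.L γ b₀ p₀ j / 4) U → PlaqSmall (θBal F.L γ b₀ p₀ j / 4) V → PlaqSmall (θBal F.L γ b₀ p₀ j / 4) W → PlaqSmall (θBal F.L γ b₀ p₀ j / 4) Z → (∀ e, e ≠ b → V e = U e) → V b = U b * expPt v → (∀ e, e ≠ b' → W e = U e) → W b' = U b' * expPt v' → (∀ e, e ≠ b' → Z e = V e) → Z b' = V b' * expPt v' → |(Real.log (ρ j Z) - Real.log (ρ' j Z) - ((F.L : ℝ) ^ j / γ) * ∑ p, c' p * (1 - reTr (GaugeField.plaqHol Z p))) - (Real.log (ρ j V) - Real.log (ρ' j V) - ((F.L : ℝ) ^ j / γ) * ∑ p, c' p * (1 - reTr (GaugeField.plaqHol V p))) - (Real.log (ρ j W) - Real.log (ρ' j W) - ((F.L : ℝ) ^ j / γ) * ∑ p, c' p * (1 - reTr (GaugeField.plaqHol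 W p))) + (Real.log (ρ j U) - Real.log (ρ' j U) - ((F.L : ℝ) ^ j / γ) * ∑ p, c' p * (1 - reTr (GaugeField.plaqHol U p)))| ≤ k' b b' * (‖v‖ / (θBal F.L γ b₀ p₀ j / 4)) * (‖v'‖ / (θBal F.L γ b₀ p₀ j / 4))))) : (∃ pW : ℝ, ∃ γ₁ : ℝ, 0 < γ₁ ∧ ∀ (F : T3Family) (γ : ℝ), 0 < γ → γ ≤ γ₁ → ∀ (b₀ p₀ κ : ℝ) (j₀ : ℕ) (prm : ℕ → ClassParams) (η : ℕ → ℝ) (rA : ℝ) (Bρ : ℕ → ℝ), 0 < b₀ → 0 < p₀ → pW ≤ p₀ → AdmissibleClassParams F γ b₀ p₀ prm → 0 < κ → (∀ j, 0 ≤ η j) → Summable η → Summable (fun i => ∑' k, η (k + i)) → Tendsto (fun j => (∑' k, η (k + j)) * ((1 + 2 * ((F.L : ℝ) ^ j / γ) * (Fintype.card (Plaq (F.P j) 0) : ℝ)) * (Fintype.card (PBond (F.P j) 0) : ℝ) ^ 2)) atTop (𝓝 0) → 0 < rA → ∃ (Cs w₀ : ℝ) (δ : ℕ → ℝ) (j₁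 : ℕ), 0 ≤ Cs ∧ 0 < w₀ ∧ (∀ j, 0 ≤ δ j) ∧ Summable δ ∧ Summable (fun i => ∑' k, δ (k + i)) ∧ Tendsto (fun j => (∑' k, δ (k + j)) * ((1 + 2 * ((F.L : ℝ) ^ j / γ) * (Fintype.card (Plaq (F.P j) 0) : ℝ)) * (Fintype.card (PBond (F.P j) 0) : ℝ) ^ 2)) atTop (𝓝 0) ∧ j₀ ≤ j₁ ∧ ∀ (ν : ℕ → (j : ℕ) → MeasureTheory.Measure (GaugeField (F.P j) 0 ↥(Matrix.specialUnitaryGroup (Fin 2) ℂ))), (∀ K, ν K K = T4GenFunBounds.gibbsMeasure (F.P K) ((F.scheme ℰp γ).β K)) → (∀ K j, j < K → ν K j = Measure.map (descend F ℰp j) (ν K (j + 1))) → ∀ (K K' : ℕ), K ≤ K' → ∀ (T Tt : ℕ), T < Tt → Tt ≤ K → ∀ (μ μ' : ((j : ℕ) → MeasureTheory.Measure (GaugeField (F.P j) 0 ↥(Matrix.specialUnitaryGroup (Fin 2) ℂ)))) (ρ ρ' : ((j : ℕ) → GaugeField (F.P j) 0 ↥(Matrix.specialUnitaryGroup (Fin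 2) ℂ) → ℝ)), (∀ j : ℕ, T ≤ j → j ≤ Tt → μ j = ν K j ∧ μ' j = ν K' j) → (∀ j : ℕ, j < T → μ j = Measure.map (descend F ℰp j) ((μ (j + 1)).withDensity (fun U => ENNReal.ofReal ((∏ p : Plaq _ _, max 0 (min 1 ((24 / 25 * (θBal F.L γ b₀ p₀ (j + 1)) - dist1 (GaugeField.plaqHol U p)) / ((24 / 25 - 1 / 2) * (θBal F.L γ b₀ p₀ (j + 1))))))))) ∧ μ' j = Measure.map (descend F ℰp j) ((μ' (j + 1)).withDensity (fun U => ENNReal.ofReal ((∏ p : Plaq _ _, max 0 (min 1 ((24 / 25 * (θBal F.L γ b₀ p₀ (j + 1)) - dist1 (GaugeField.plaqHol U p)) / ((24 / 25 - 1 / 2) * (θBal F.L γ b₀ p₀ (j + 1)))))))))) → (∀ j : ℕ, T ≤ j → j < Tt → μ j = Measure.map (descend F ℰp j) (μ (j + 1)) ∧ μ' j = Measure.map (descend F ℰp j) (μ' (j + 1))) → (∀ j : ℕ, j ≤ Tt → IsFiniteMeasure (μ j) ∧ IsFiniteMeasure (μ' j)) → (∀ j : ℕ, j₀ ≤ j →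 j ≤ Tt → ((∀ U, PlaqSmall (θBal F.L γ b₀ p₀ j) U → 0 < ρ j U ∧ 0 < ρ' j U) ∧ μ j = (fieldMeasure _ _ _).withDensity (fun U => ENNReal.ofReal (ρ j U)) ∧ μ' j = (fieldMeasure _ _ _).withDensity (fun U => ENNReal.ofReal (ρ' j U)) ∧ (∃ κ : ℝ, MemAtHeight F ℰp j (prm j) (fun U => Real.exp κ * ρ j U)) ∧ (∃ κ : ℝ, MemAtHeight F ℰp j (prm j) (fun U => Real.exp κ * ρ' j U)) ∧ μ j {U | ¬ PlaqSmall (θBal F.L γ b₀ p₀ j) U} ≤ ENNReal.ofReal (η j) ∧ μ' j {U | ¬ PlaqSmall (θBal F.L γ b₀ p₀ j) U} ≤ ENNReal.ofReal (η j) ∧ (ContinuousOn (ρ j) {U | PlaqSmall (θBal F.L γ b₀ p₀ j) U} ∧ ContinuousOn (ρ' j) {U | PlaqSmall (θBal F.L γ b₀ p₀ j) U}) ∧ ((∀ (U : GaugeField _ _ ↥(Matrix.specialUnitaryGroup (Fin 2) ℂ)), PlaqSmall (θBal F.L γ b₀ p₀ j / 2) U → ∀ (b b' : PBond _ _) (v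 v' : Fin 3 → ℝ), ‖v‖ ≤ 1 → ‖v'‖ ≤ 1 → ∃ g : ℂ × ℂ → ℂ, DifferentiableOn ℂ g (Metric.ball (0 : ℂ) (rA * (θBal F.L γ b₀ p₀ j / 2)) ×ˢ Metric.ball (0 : ℂ) (rA * (θBal F.L γ b₀ p₀ j / 2))) ∧ (∀ (s t : ℝ) (V Z : GaugeField _ _ ↥(Matrix.specialUnitaryGroup (Fin 2) ℂ)), |s| < rA * (θBal F.L γ b₀ p₀ j / 2) → |t| < rA * (θBal F.L γ b₀ p₀ j / 2) → (∀ e, e ≠ b → V e = U e) → V b = U b * expPt (s • v) → (∀ e, e ≠ b' → Z e = V e) → Z b' = V b' * expPt (t • v') → g ((s : ℂ), (t : ℂ)) = (((Real.log (ρ j Z)) : ℝ) : ℂ)) ∧ ∀ z ∈ Metric.ball (0 : ℂ) (rA * (θBal F.L γ b₀ p₀ j / 2)) ×ˢ Metric.ball (0 : ℂ) (rA * (θBal F.L γ b₀ p₀ j / 2)), ‖g z - g 0‖ ≤ (Bρ j)) ∧ (∀ (U : GaugeField _ _ ↥(Matrix.specialUnitaryGroup (Fin 2) ℂ)), PlaqSmall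 (θBal F.L γ b₀ p₀ j / 2) U → ∀ (b b' : PBond _ _) (v v' : Fin 3 → ℝ), ‖v‖ ≤ 1 → ‖v'‖ ≤ 1 → ∃ g : ℂ × ℂ → ℂ, DifferentiableOn ℂ g (Metric.ball (0 : ℂ) (rA * (θBal F.L γ b₀ p₀ j / 2)) ×ˢ Metric.ball (0 : ℂ) (rA * (θBal F.L γ b₀ p₀ j / 2))) ∧ (∀ (s t : ℝ) (V Z : GaugeField _ _ ↥(Matrix.specialUnitaryGroup (Fin 2) ℂ)), |s| < rA * (θBal F.L γ b₀ p₀ j / 2) → |t| < rA * (θBal F.L γ b₀ p₀ j / 2) → (∀ e, e ≠ b → V e = U e) → V b = U b * expPt (s • v) → (∀ e, e ≠ b' → Z e = V e) → Z b' = V b' * expPt (t • v') → g ((s : ℂ), (t : ℂ)) = (((Real.log (ρ' j Z)) : ℝ) : ℂ)) ∧ ∀ z ∈ Metric.ball (0 : ℂ) (rA * (θBal F.L γ b₀ p₀ j / 2)) ×ˢ Metric.ball (0 : ℂ) (rA * (θBal F.L γ b₀ p₀ j / 2)), ‖g z - g 0‖ ≤ (Bρ j))))) → ∀ (wT : ℝ),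 0 ≤ wT → wT / (((F.L : ℝ) ^ T / γ) * θBal F.L γ b₀ p₀ T ^ 2) ≤ w₀ → (∃ kT : PBond (F.P T) 0 → PBond (F.P T) 0 → ℝ, (∀ b b', 0 ≤ kT b b') ∧ (∀ b, ∑ b', kT b b' * Real.exp (κ * (b.src.tdist b'.src : ℝ)) ≤ wT) ∧ (∀ (b b' : PBond _ _) (v v' : Fin 3 → ℝ) (U V W Z : GaugeField _ _ ↥(Matrix.specialUnitaryGroup (Fin 2) ℂ)), ‖v‖ ≤ (rA / 2) * (θBal F.L γ b₀ p₀ T / 4) → ‖v'‖ ≤ (rA / 2) * (θBal F.L γ b₀ p₀ T / 4) → PlaqSmall (θBal F.L γ b₀ p₀ T / 4) U → PlaqSmall (θBal F.L γ b₀ p₀ T / 4) V → PlaqSmall (θBal F.L γ b₀ p₀ T / 4) W → PlaqSmall (θBal F.L γ b₀ p₀ T / 4) Z → (∀ e, e ≠ b → V e = U e) → V b = U b * expPt v → (∀ e, e ≠ b' → W e = U e) → W b' = U b' * expPt v' → (∀ e, e ≠ b' → Z e = V e) → Z b' = V b' * expPt v' → |(Real.log (ρ T Z) - Real.log (ρ'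 T Z)) - (Real.log (ρ T V) - Real.log (ρ' T V)) - (Real.log (ρ T W) - Real.log (ρ' T W)) + (Real.log (ρ T U) - Real.log (ρ' T U))| ≤ kT b b' * (‖v‖ / (θBal F.L γ b₀ p₀ T / 4)) * (‖v'‖ / (θBal F.L γ b₀ p₀ T / 4)))) → ∀ (j : ℕ), j₁ ≤ j → j ≤ T → ∀ U : GaugeField (F.P j) 0 ↥(Matrix.specialUnitaryGroup (Fin 2) ℂ), PlaqSmall (θBal F.L γ (Real.sqrt (b₀ / 8)) (p₀ / 2) j) U → |(Real.log (ρ j U) - Real.log (ρ' j U)) - (Real.log (ρ j 1) - Real.log (ρ' j 1))| ≤ (Cs * (wT / (((F.L : ℝ) ^ T / γ) * θBal F.L γ b₀ p₀ T ^ 2)) + δ j) * (((F.L : ℝ) ^ j / γ) * (2 * (Fintype.card (Plaq (F.P j) 0) : ℝ) + (Fintype.card (PBond (F.P j) 0) : ℝ) ^ 2))) :=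
  directTransport_supR hO
    Summit.QuantumFields.YangMills.Theorems.OrganTangentSmallStepChordPath.exists_smallStep_chordPath_gaugeCopy

end Summit.QuantumFields.YangMills.Theorems.OrganTangentJunctionDirectTransport

end
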